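import Summits.AtomisticToContinuum.BoseEinsteinCondensation.Theorems.BECGroundStateSOSPeriodicIRBoundPFMinimiserUnique
import HarnessLib

/-!
# Perron–Frobenius uniqueness of the periodic Bose ground state, part 2: the ground state is simple

Final file (part 2 of 2) for the stub `stub_minimiserUniqueOfPositive` (S-C2) of line `linear-ph-floor-wagner`
of the crux `BECGroundStateSOS.PeriodicIRBound` (item stmt-AtomisticToContinuum-3972); sequel of
`…PFMinimiserUnique.lean`. Classical source: [ReedSimonIV1978, §XIII.12, Thms XIII.43–44].

* `real_groundState_eq_smul` — KEY ⇒ two real Bose maximal-form ground states are proportional (orthogonal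
  real ground states would both have strict signs, and `∫ g k ≠ 0` for such);
* `stub_minimiserUniqueOfPositive` — KEY ⇒ two normalised Bose-symmetric maximal-form minimisers are never
  orthogonal (the ground-state class is the complex line `ℂ·g`).
-/

noncomputable section

namespace Summit.AtomisticToContinuum.BoseEinsteinCondensation.Cruxes.PeriodicIRBound.LinearPhFloorWagner

open MeasureTheory Filter UnitAddTorus
open scoped ENNReal NNReal Topology InnerProductSpace ComplexConjugate
open Literature.MathematicalPhysics.QuantumManyBody
open Literature.MathematicalPhysics.QuantumManyBody.BoseGas

-- The measure on `ℝ/ℤ` is the Haar PROBABILITY measure, as in `PeriodicFormDomain.lean`.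
attribute [local instance] Literature.MathematicalPhysics.QuantumManyBody.BoseGas.formDomain_measureSpace
  Literature.MathematicalPhysics.QuantumManyBody.BoseGas.formDomain_isProbabilityMeasure
  Literature.MathematicalPhysics.QuantumManyBody.BoseGas.formDomain_isProbabilityMeasure_pi

variable {N : ℕ} {L : ℝ}

/-- Local notation for the Hilbert space `L²((ℝ/ℤ)^{3N})`, as in `PeriodicFormDomain.lean`. -/
local notation "L2T " N':max => Lp ℂ 2 (volume : Measure (UnitAddTorus (Fin N' × Fin 3)))

set_option quotPrecheck false in
/-- Local notation: the positivity statement KEY (stub S-B of the line), taken as a hypothesis. -/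
local notation "KEYPROP" => ∀ {N : ℕ}, 1 ≤ N → ∀ {L : ℝ}, 0 < L → ∀ {v : ℝ → ℝ≥0∞}, IsRepulsiveFiniteRange v →
    (∫⁻ x : Space, v ‖x‖) ≠ ⊤ →
      ∀ f : Config N → ℝ, Measurable f → (∀ X, 0 ≤ f X) →
        (∀ (X : Config N) (i : Fin N) (k : Fin 3), f (X + Pi.single i (EuclideanSpace.single k L)) = f X) →
        (∫⁻ X in cellN N L, ENNReal.ofReal (f X ^ 2)) = 1 →
        (∀ ε : ℝ, 0 < ε → ∃ φ : Config N → ℝ, ContDiff ℝ 1 φ ∧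
          (∀ (X : Config N) (i : Fin N) (k : Fin 3), φ (X + Pi.single i (EuclideanSpace.single k L)) = φ X) ∧
          (∫⁻ X in cellN N L, ENNReal.ofReal ((φ X - f X) ^ 2)) ≤ ENNReal.ofReal ε ∧
          (∫⁻ X in cellN N L, realKinetic φ X) +
              (∫⁻ X in cellN N L, ENNReal.ofReal (φ X ^ 2) * periodicInteraction v L X) ≤
            periodicGroundStateEnergy v N L + ENNReal.ofReal ε) →
        ∀ᵐ X ∂(volume.restrict (cellN N L)), 0 < f X

/-! ### The real ground states form a line -/

section Line

/-- The inner product of two a.e. real classes is the integral of the product of their real parts.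
[folklore] -/
theorem inner_eq_integral_re_mul_re (x y : L2T N)
    (hx : ∀ᵐ t ∂(volume : Measure (UnitAddTorus (Fin N × Fin 3))), (x : UnitAddTorus (Fin N × Fin 3) → ℂ) t =
      ((((x : UnitAddTorus (Fin N × Fin 3) → ℂ) t).re : ℝ) : ℂ))
    (hy : ∀ᵐ t ∂(volume : Measure (UnitAddTorus (Fin N × Fin 3))), (y : UnitAddTorus (Fin N × Fin 3) → ℂ) t =
      ((((y : UnitAddTorus (Fin N × Fin 3) → ℂ) t).re : ℝ) : ℂ)) :
    ⟪x, y⟫_ℂ = ((∫ t, ((x : UnitAddTorus (Fin N × Fin 3) → ℂ) t).re * ((y : UnitAddTorus (Fin N × Fin 3) → ℂ) t).re : ℝ) : ℂ) := by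
  have h : ∫ t, (((((x : UnitAddTorus (Fin N × Fin 3) → ℂ) t).re * ((y : UnitAddTorus (Fin N × Fin 3) → ℂ) t).re : ℝ)) : ℂ) =
      ((∫ t, ((x : UnitAddTorus (Fin N × Fin 3) → ℂ) t).re * ((y : UnitAddTorus (Fin N × Fin 3) → ℂ) t).re : ℝ) : ℂ) :=
    integral_ofReal
  rw [MeasureTheory.L2.inner_def, ← h]
  refine integral_congr_ae ?_
  filter_upwards [hx, hy] with t h1 h2
  rw [RCLike.inner_apply']
  conv_lhs => rw [h1, h2]
  rw [Complex.conj_ofReal, ← Complex.ofReal_mul]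

/-- The real part of the pointwise inner product of two `L²` classes is integrable. [folklore] -/
theorem integrable_re_mul_re (x y : L2T N) :
    Integrable (fun t => ((x : UnitAddTorus (Fin N × Fin 3) → ℂ) t).re * ((y : UnitAddTorus (Fin N × Fin 3) → ℂ) t).re -
      -(((x : UnitAddTorus (Fin N × Fin 3) → ℂ) t).im * ((y : UnitAddTorus (Fin N × Fin 3) → ℂ) t).im))
      (volume : Measure (UnitAddTorus (Fin N × Fin 3))) := by
  have h := (MeasureTheory.L2.integrable_inner (𝕜 := ℂ) x y).re
  refine h.congr (Eventually.of_forall fun t => ?_)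
  simp only [RCLike.inner_apply', RCLike.re_to_complex, Complex.mul_re, Complex.conj_re, Complex.conj_im]
  ring

/-- **Two real ground states are proportional**: if `g ≠ 0` and `k` are real elements of the ground-state
class, then `k = c • g` for a real `c` — otherwise `k - cg ⊥ g` would be a nonzero real ground state, and two
real ground states of strict signs are never orthogonal. [cite: ReedSimonIV1978, §XIII.12 Thm. XIII.44] -/
theorem real_groundState_eq_smul (KEY : KEYPROP) (hN : 1 ≤ N) (hL : 0 < L) {v : ℝ → ℝ≥0∞}
    (hv : IsRepulsiveFiniteRange v) (hint : (∫⁻ x : Space, v ‖x‖) ≠ ⊤) (g k : L2T N) (hg0 : g ≠ 0)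
    (hgM : g ∈ maxFormGroundStates v N L)
    (hgr : ∀ᵐ t ∂(volume : Measure (UnitAddTorus (Fin N × Fin 3))), (g : UnitAddTorus (Fin N × Fin 3) → ℂ) t =
      ((((g : UnitAddTorus (Fin N × Fin 3) → ℂ) t).re : ℝ) : ℂ))
    (hkM : k ∈ maxFormGroundStates v N L)
    (hkr : ∀ᵐ t ∂(volume : Measure (UnitAddTorus (Fin N × Fin 3))), (k : UnitAddTorus (Fin N × Fin 3) → ℂ) t =
      ((((k : UnitAddTorus (Fin N × Fin 3) → ℂ) t).re : ℝ) : ℂ)) :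
    ∃ c : ℝ, k = (c : ℂ) • g := by
  have hWint := WF.lintegral_cellN_periodicInteraction_ne_top hL hv.1 hint N
  have hE := periodicGroundStateEnergy_integrable_ne_top hL hv.1 hint N
  have hgn : ‖g‖ ≠ 0 := norm_ne_zero_iff.2 hg0
  set c : ℝ := (⟪g, k⟫_ℂ).re / ‖g‖ ^ 2 with hc
  refine ⟨c, ?_⟩
  set k' : L2T N := k - (c : ℂ) • g with hk'
  have hk'M : k' ∈ maxFormGroundStates v N L :=
    sub_mem_maxFormGroundStates hL hv.1 hWint hE hkM (smul_mem_maxFormGroundStates _ hgM)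
  have hk'r : ∀ᵐ t ∂(volume : Measure (UnitAddTorus (Fin N × Fin 3))), (k' : UnitAddTorus (Fin N × Fin 3) → ℂ) t =
      ((((k' : UnitAddTorus (Fin N × Fin 3) → ℂ) t).re : ℝ) : ℂ) := by
    filter_upwards [Lp.coeFn_sub k ((c : ℂ) • g), Lp.coeFn_smul (c : ℂ) g, hgr, hkr] with t h1 h2 h3 h4
    rw [h1, Pi.sub_apply, h2, Pi.smul_apply, smul_eq_mul]
    conv_lhs => rw [h3, h4]
    conv_rhs => rw [h3, h4]
    simp only [Complex.sub_re, Complex.mul_re, Complex.ofReal_re, Complex.ofReal_im, mul_zero, sub_zero,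
      Complex.ofReal_sub, Complex.ofReal_mul]
  -- `k' ⊥ g`
  have hgk : ⟪g, k⟫_ℂ = (((⟪g, k⟫_ℂ).re : ℝ) : ℂ) := by
    rw [inner_eq_integral_re_mul_re g k hgr hkr, Complex.ofReal_re]
  have horth : ⟪g, k'⟫_ℂ = 0 := by
    have hgnC : ((‖g‖ : ℝ) : ℂ) ≠ 0 := Complex.ofReal_ne_zero.2 hgn
    have hgg : ⟪g, g⟫_ℂ = (((‖g‖ : ℝ) : ℂ)) ^ 2 := inner_self_eq_norm_sq_to_K g
    rw [hk', inner_sub_right, inner_smul_right, hgg, hc]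
    conv_lhs => rw [hgk]
    rw [Complex.ofReal_re, Complex.ofReal_div, Complex.ofReal_pow, div_mul_cancel₀ _ (pow_ne_zero 2 hgnC), sub_self]
  -- hence `k' = 0`
  by_contra hne
  have hk'0 : k' ≠ 0 := fun h0 => hne (by rw [← sub_eq_zero, ← hk', h0])
  set p : UnitAddTorus (Fin N × Fin 3) → ℝ := fun t =>
    ((g : UnitAddTorus (Fin N × Fin 3) → ℂ) t).re * ((k' : UnitAddTorus (Fin N × Fin 3) → ℂ) t).re with hp
  have hpint : Integrable p (volume : Measure (UnitAddTorus (Fin N × Fin 3))) := by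
    refine (integrable_re_mul_re g k').congr ?_
    filter_upwards [hgr] with t ht
    have him : ((g : UnitAddTorus (Fin N × Fin 3) → ℂ) t).im = 0 := by rw [ht, Complex.ofReal_im]
    simp only [hp, him, zero_mul, neg_zero, sub_zero]
  have hint0 : ∫ t, p t = 0 := by
    have h := horth
    rw [inner_eq_integral_re_mul_re g k' hgr hk'r, Complex.ofReal_eq_zero] at h
    exact h
  have hμ : (volume : Measure (UnitAddTorus (Fin N × Fin 3))) ≠ 0 := IsProbabilityMeasure.ne_zero _
  haveI : (ae (volume : Measure (UnitAddTorus (Fin N × Fin 3)))).NeBot := ae_neBot.2 hμ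
  -- strict signs of `g` and `k'`
  have hsg := ae_sign_of_real_groundState KEY hN hL hv hint g hg0 hgM hgr
  have hsk := ae_sign_of_real_groundState KEY hN hL hv hint k' hk'0 hk'M hk'r
  have hcases : (∀ᵐ t ∂(volume : Measure (UnitAddTorus (Fin N × Fin 3))), 0 < p t) ∨
      (∀ᵐ t ∂(volume : Measure (UnitAddTorus (Fin N × Fin 3))), 0 < -p t) := by
    rcases hsg with hg' | hg' <;> rcases hsk with hk'' | hk''
    · exact Or.inl (by filter_upwards [hg', hk''] with t a b; exact mul_pos a b)
    · exact Or.inr (by filter_upwards [hg', hk''] with t a b; simp only [hp, neg_pos]; exact mul_neg_of_pos_of_neg a b)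
    · exact Or.inr (by filter_upwards [hg', hk''] with t a b; simp only [hp, neg_pos]; exact mul_neg_of_neg_of_pos a b)
    · exact Or.inl (by filter_upwards [hg', hk''] with t a b; exact mul_pos_of_neg_of_neg a b)
  rcases hcases with hpos | hpos
  · have hzero := (integral_eq_zero_iff_of_nonneg_ae (hpos.mono fun t ht => ht.le) hpint).1 hint0
    have hfalse : ∀ᵐ t ∂(volume : Measure (UnitAddTorus (Fin N × Fin 3))), False := by
      filter_upwards [hpos, hzero] with t h1 h2
      simp only [Pi.zero_apply] at h2
      linarith
    exact hfalse.exists.elim fun _ h => h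
  · have hint0' : ∫ t, -p t = 0 := by rw [integral_neg, hint0, neg_zero]
    have hzero := (integral_eq_zero_iff_of_nonneg_ae (hpos.mono fun t ht => ht.le) hpint.neg).1 hint0'
    have hfalse : ∀ᵐ t ∂(volume : Measure (UnitAddTorus (Fin N × Fin 3))), False := by
      filter_upwards [hpos, hzero] with t h1 h2
      simp only [Pi.zero_apply] at h2
      linarith
    exact hfalse.exists.elim fun _ h => h

end Line

/-! ### Uniqueness of the ground state up to phase -/

section Final

/-- **KEY ⇒ uniqueness of the maximal-form Bose ground state up to phase** (registered stub S-C2 of line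
`linear-ph-floor-wagner`): if nonnegative normalised `L²(cell)`-limits of real periodic `C¹` functions of
energy `→ E₀` are a.e. positive (KEY, hypothesis), then two `L²`-normalised Bose-symmetric maximal-form
minimisers `η₁, η₂` (`Q_v(ηᵢ) ≤ E₀`) are never orthogonal: the ground-state class is the complex line `ℂ·g`
(real and imaginary parts are ground states, real ground states have strict signs, orthogonal real ground
states cannot both have strict signs). [cite: ReedSimonIV1978, §XIII.12 Thms XIII.43–XIII.44] -/
theorem stub_minimiserUniqueOfPositive :
    (∀ {N : ℕ}, 1 ≤ N → ∀ {L : ℝ}, 0 < L → ∀ {v : ℝ → ℝ≥0∞}, IsRepulsiveFiniteRange v → (∫⁻ x : Space, v ‖x‖) ≠ ⊤ →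
      ∀ f : Config N → ℝ, Measurable f → (∀ X, 0 ≤ f X) →
        (∀ (X : Config N) (i : Fin N) (k : Fin 3), f (X + Pi.single i (EuclideanSpace.single k L)) = f X) →
        (∫⁻ X in cellN N L, ENNReal.ofReal (f X ^ 2)) = 1 →
        (∀ ε : ℝ, 0 < ε → ∃ φ : Config N → ℝ, ContDiff ℝ 1 φ ∧
          (∀ (X : Config N) (i : Fin N) (k : Fin 3), φ (X + Pi.single i (EuclideanSpace.single k L)) = φ X) ∧
          (∫⁻ X in cellN N L, ENNReal.ofReal ((φ X - f X) ^ 2)) ≤ ENNReal.ofReal ε ∧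
          (∫⁻ X in cellN N L, realKinetic φ X) +
              (∫⁻ X in cellN N L, ENNReal.ofReal (φ X ^ 2) * periodicInteraction v L X) ≤
            periodicGroundStateEnergy v N L + ENNReal.ofReal ε) →
        ∀ᵐ X ∂(volume.restrict (cellN N L)), 0 < f X) →
    ∀ {N : ℕ}, 1 ≤ N → ∀ {L : ℝ} (hL : 0 < L) {v : ℝ → ℝ≥0∞}, IsRepulsiveFiniteRange v → (∫⁻ x : Space, v ‖x‖) ≠ ⊤ →
      ∀ η₁ η₂ : Lp ℂ 2 (volume : Measure (UnitAddTorus (Fin N × Fin 3))),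
        ‖η₁‖ = 1 → ‖η₂‖ = 1 →
        (∀ (σ : Equiv.Perm (Fin N)) (n : Fin N × Fin 3 → ℤ),
          ⟪(mFourierLp 2 (fun p : Fin N × Fin 3 => n (σ p.1, p.2)) : Lp ℂ 2 (volume : Measure (UnitAddTorus (Fin N × Fin 3)))), η₁⟫_ℂ =
            ⟪(mFourierLp 2 n : Lp ℂ 2 (volume : Measure (UnitAddTorus (Fin N × Fin 3)))), η₁⟫_ℂ) →
        (∀ (σ : Equiv.Perm (Fin N)) (n : Fin N × Fin 3 → ℤ),
          ⟪(mFourierLp 2 (fun p : Fin N × Fin 3 => n (σ p.1, p.2)) : Lp ℂ 2 (volume : Measure (UnitAddTorus (Fin N × Fin 3)))), η₂⟫_ℂ =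
            ⟪(mFourierLp 2 n : Lp ℂ 2 (volume : Measure (UnitAddTorus (Fin N × Fin 3)))), η₂⟫_ℂ) →
        (∑' n : Fin N × Fin 3 → ℤ, ENNReal.ofReal (∑ p, (2 * Real.pi * (n p : ℝ) / L) ^ 2) *
              (‖⟪(mFourierLp 2 n : Lp ℂ 2 (volume : Measure (UnitAddTorus (Fin N × Fin 3)))), η₁⟫_ℂ‖₊ : ℝ≥0∞) ^ 2 +
            ∫⁻ t, periodicInteraction v L (fromUnitTorusN L t) *
              (‖(η₁ : UnitAddTorus (Fin N × Fin 3) → ℂ) t‖₊ : ℝ≥0∞) ^ 2) ≤ periodicGroundStateEnergy v N L →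
        (∑' n : Fin N × Fin 3 → ℤ, ENNReal.ofReal (∑ p, (2 * Real.pi * (n p : ℝ) / L) ^ 2) *
              (‖⟪(mFourierLp 2 n : Lp ℂ 2 (volume : Measure (UnitAddTorus (Fin N × Fin 3)))), η₂⟫_ℂ‖₊ : ℝ≥0∞) ^ 2 +
            ∫⁻ t, periodicInteraction v L (fromUnitTorusN L t) *
              (‖(η₂ : UnitAddTorus (Fin N × Fin 3) → ℂ) t‖₊ : ℝ≥0∞) ^ 2) ≤ periodicGroundStateEnergy v N L →
        ⟪η₁, η₂⟫_ℂ ≠ 0 := by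
  intro KEY N hN L hL v hv hint η₁ η₂ h1 h2 hs1 hs2 hQ1 hQ2
  have hWint := WF.lintegral_cellN_periodicInteraction_ne_top hL hv.1 hint N
  have hE := periodicGroundStateEnergy_integrable_ne_top hL hv.1 hint N
  -- `η₁, η₂` are ground states
  have hM1 : η₁ ∈ maxFormGroundStates v N L := by
    refine ⟨hs1, ?_⟩
    rw [h1, one_pow, ENNReal.ofReal_one, mul_one]
    exact hQ1
  have hM2 : η₂ ∈ maxFormGroundStates v N L := by
    refine ⟨hs2, ?_⟩
    rw [h2, one_pow, ENNReal.ofReal_one, mul_one]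
    exact hQ2
  -- real and imaginary parts are real ground states
  have hR₁ := reLp_mem_maxFormGroundStates hL hv.1 hWint hE hM1
  have hJ₁ := imLp_mem_maxFormGroundStates hL hv.1 hWint hE hM1
  have hR₂ := reLp_mem_maxFormGroundStates hL hv.1 hWint hE hM2
  have hJ₂ := imLp_mem_maxFormGroundStates hL hv.1 hWint hE hM2
  have real_of : ∀ (X : L2T N) (f : UnitAddTorus (Fin N × Fin 3) → ℝ),
      (∀ᵐ t ∂(volume : Measure (UnitAddTorus (Fin N × Fin 3))), (X : UnitAddTorus (Fin N × Fin 3) → ℂ) t = ((f t : ℝ) : ℂ)) →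
      ∀ᵐ t ∂(volume : Measure (UnitAddTorus (Fin N × Fin 3))), (X : UnitAddTorus (Fin N × Fin 3) → ℂ) t =
        ((((X : UnitAddTorus (Fin N × Fin 3) → ℂ) t).re : ℝ) : ℂ) :=
    fun X f h => h.mono fun t ht => by rw [ht, Complex.ofReal_re]
  have hR₁r := real_of (reLp η₁) (fun t => ((η₁ : UnitAddTorus (Fin N × Fin 3) → ℂ) t).re) (coeFn_reLp η₁)
  have hJ₁r := real_of (imLp η₁) (fun t => ((η₁ : UnitAddTorus (Fin N × Fin 3) → ℂ) t).im) (coeFn_imLp η₁)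
  have hR₂r := real_of (reLp η₂) (fun t => ((η₂ : UnitAddTorus (Fin N × Fin 3) → ℂ) t).re) (coeFn_reLp η₂)
  have hJ₂r := real_of (imLp η₂) (fun t => ((η₂ : UnitAddTorus (Fin N × Fin 3) → ℂ) t).im) (coeFn_imLp η₂)
  -- a nonzero real ground state `g`
  obtain ⟨g, hg0, hgM, hgr⟩ : ∃ g : L2T N, g ≠ 0 ∧ g ∈ maxFormGroundStates v N L ∧
      ∀ᵐ t ∂(volume : Measure (UnitAddTorus (Fin N × Fin 3))), (g : UnitAddTorus (Fin N × Fin 3) → ℂ) t =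
        ((((g : UnitAddTorus (Fin N × Fin 3) → ℂ) t).re : ℝ) : ℂ) := by
    by_cases hR : reLp η₁ = 0
    · refine ⟨imLp η₁, fun hJ => ?_, hJ₁, hJ₁r⟩
      have hdec := reLp_add_I_smul_imLp η₁
      rw [hR, hJ, smul_zero, add_zero] at hdec
      rw [← hdec, norm_zero] at h1
      exact zero_ne_one h1
    · exact ⟨reLp η₁, hR, hR₁, hR₁r⟩
  -- all real ground states are real multiples of `g`
  obtain ⟨a₁, ha₁⟩ := real_groundState_eq_smul KEY hN hL hv hint g (reLp η₁) hg0 hgM hgr hR₁ hR₁r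
  obtain ⟨b₁, hb₁⟩ := real_groundState_eq_smul KEY hN hL hv hint g (imLp η₁) hg0 hgM hgr hJ₁ hJ₁r
  obtain ⟨a₂, ha₂⟩ := real_groundState_eq_smul KEY hN hL hv hint g (reLp η₂) hg0 hgM hgr hR₂ hR₂r
  obtain ⟨b₂, hb₂⟩ := real_groundState_eq_smul KEY hN hL hv hint g (imLp η₂) hg0 hgM hgr hJ₂ hJ₂r
  have hη1 : η₁ = ((a₁ : ℂ) + Complex.I * b₁) • g := by
    rw [← reLp_add_I_smul_imLp η₁, ha₁, hb₁, smul_smul, ← add_smul]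
  have hη2 : η₂ = ((a₂ : ℂ) + Complex.I * b₂) • g := by
    rw [← reLp_add_I_smul_imLp η₂, ha₂, hb₂, smul_smul, ← add_smul]
  have hα : ((a₁ : ℂ) + Complex.I * b₁) ≠ 0 := by
    intro h0
    rw [h0, zero_smul] at hη1
    rw [hη1, norm_zero] at h1
    exact zero_ne_one h1
  have hβ : ((a₂ : ℂ) + Complex.I * b₂) ≠ 0 := by
    intro h0
    rw [h0, zero_smul] at hη2
    rw [hη2, norm_zero] at h2
    exact zero_ne_one h2
  rw [hη1, hη2, inner_smul_left, inner_smul_right]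
  exact mul_ne_zero ((map_ne_zero _).2 hα) (mul_ne_zero hβ (inner_self_ne_zero.2 hg0))

end Final

end Summit.AtomisticToContinuum.BoseEinsteinCondensation.Cruxes.PeriodicIRBound.LinearPhFloorWagner

end
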